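import Literature.NumberTheory.IwasawaTheory.ClassicalMuVanishesUnitNormIndexGenerated
import HarnessLib

/-!
# Chevalley's formula in prime degree for EVERY prime, unramified at infinity: `#Cl(L)^G = h_K`,
# `p ∤ h_L` (door U) and `ord_p h_L = ord_p h_K` (door UG), with the unit-free core of door UG

Topic `NumberTheory/NumberFields`; namespace `Literature.NumberTheory.NumberFields.AmbiguousClass`.  THEOREMS ONLY
(no definition, no named fact, no instance, no `sorry`).  The number-field half of the all-prime unit-norm-index
doors (the `ℤ_p`-tower half is `IwasawaTheory/ClassicalMuVanishesUnitNormIndexAnyPrime.lean`).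

The tree's doors `ClassicalMuVanishesUnitNormIndex.lean` §1 (door U: `L/K` Galois of prime degree `p`, `p ∤ h_K`,
at most `s` ramified primes, unit norm index `[E_K : E_K ∩ N_{L/K} Lˣ] · p = p^s` ⟹ `#Cl(L)^G = h_K`, `p ∤ h_L`) and
`ClassicalMuVanishesUnitNormIndexGenerated.lean` §1 (door UG: exactly `s` ramified primes, index `p^{s-1}`, ramified
classes generating `Cl(K)` modulo `p` ⟹ `ord_p h_L = ord_p h_K`) assume `p` ODD — oddness being used ONLY to get
`∏_{v∣∞} e_v = 1` in Chevalley's ambiguous class number formula (`IsUnramifiedAtInfinitePlaces_of_odd_finrank`).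
Here the archimedean condition is the Mathlib class `[IsUnramifiedAtInfinitePlaces K L]` and `p` is ANY prime, so
`p = 2` is covered (e.g. `L = K(√2)`, or any layer of a `ℤ₂`-extension — Washington §13.1); and the genus-theory
heart of door UG is isolated as a statement with NO archimedean and NO unit hypothesis:

* `card_fixed_eq_classNumber_of_relIndex_mul_eq_of_isUnramifiedAtInfinitePlaces` — `p ∤ h_K`, at most `s`
  ramified primes, `[E_K : E_K ∩ N_{L/K} Lˣ] · p = p^s` ⟹ `#Cl(L)^G = h_K`;
  `not_dvd_classNumber_of_relIndex_mul_eq_of_isUnramifiedAtInfinitePlaces` ⟹ `p ∤ h_L` (door U);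
* `card_fixed_eq_classNumber_of_ncard_eq_of_relIndex_mul_eq_of_isUnramifiedAtInfinitePlaces` — exactly `s`
  ramified primes and index `p^{s-1}` ⟹ `#Cl(L)^G = h_K` (no hypothesis on `h_K`);
* **`padicValNat_classNumber_eq_of_card_fixed_eq_classNumber_of_sup_eq_top`** — the CORE: `[L:K] = p` prime,
  `#Cl(L)^G = h_K`, and the classes of the ramified primes generate `Cl(K)` modulo `p`-th powers ⟹
  `ord_p h_L = ord_p h_K` (the `p`-odd tree proof verbatim, its Step 1 turned into the hypothesis `hFix`; so
  any other way of getting `#Cl(L)^G = h_K` — e.g. an ambiguous-class certificate — feeds it too);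
* `padicValNat_classNumber_eq_of_relIndex_mul_eq_of_sup_eq_top_of_isUnramifiedAtInfinitePlaces`,
  `…_of_torsion_le_closure_of_isUnramifiedAtInfinitePlaces` — door UG for every prime degree.

At `p = 2` the cases `s ≤ 2` are the special-shape doors of the BSD tree files (`h_K` odd, at most two primes,
one non-norm unit; `t ≤ 2`, one ambiguous class).  HONEST SCOPE: classical genus theory after Chevalley (Lang
Ch. 13 §4, Gras IV.4); nothing specific to any summit; BSD is not advanced by this file.

## References

* S. Lang, *Cyclotomic Fields I and II*, GTM 121 (1990), Ch. 13 §4, Lemma 4.1 and the paragraph after it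
  (held copy, PDF pp. 203–204); tree theorem `AmbiguousClass.ambiguousClassNumberFormula`. [Lang1990]
* G. Gras, *Class Field Theory* (2003), II.6.2.3, IV.4 (genus theory: invariant classes). [Gras2003]
* J. Neukirch, *Algebraic Number Theory* (1999), Ch. III §1 Prop. (1.6) (ii), (iv). [NeukirchANT1999]
* R. Greenberg, *Iwasawa theory — past and present* (2001), Prop. 2.1 p. 339 (one prime, `p ∤ h`). [Greenberg2001IwasawaPastPresent]
* L. C. Washington, *Introduction to Cyclotomic Fields*, 2nd ed., GTM 83 (1997), §13.1 Prop. 13.2. [Washington1997]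
-/

noncomputable section

open NumberField IsDedekindDomain
open scoped nonZeroDivisors

/-! ## §1 Number fields: Galois extensions of prime degree, unramified at the infinite places -/

namespace Literature.NumberTheory.NumberFields.AmbiguousClass

open Literature.NumberTheory.GaloisRepresentations Literature.NumberTheory.GaloisRepresentations.Herbrand
  Literature.NumberTheory.GaloisRepresentations.MinkowskiUnit
  Literature.NumberTheory.GaloisRepresentations.CyclicNormIndex

variable {K L : Type} [Field K] [NumberField K] [Field L] [NumberField L] [Algebra K L]

/-- **Chevalley in prime degree, unramified at infinity: `#Cl(L)^G = h_K`.**  Let `L/K` be a Galois extension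
of number fields of prime degree `p` (ANY prime), unramified at the infinite places (so `∏_{v∣∞} e_v = 1`,
`archFactor_eq_one`; every ramified prime is totally ramified, `∏_𝔭 e_𝔭 = p^t`, `t` the number of ramified
primes).  If `p ∤ h_K` and `[E_K : E_K ∩ N_{L/K} Lˣ] · p = p^s` for some `s ≥ t`, then Lang's Lemma 4.1
(`ambiguousClassNumberFormula`) reads `#Cl(L)^G · p^s = h_K · p^t`, whence `s = t` and `#Cl(L)^G = h_K`.  The
`p`-odd case (where the archimedean hypothesis is automatic) is `card_fixed_eq_classNumber_of_relIndex_mul_eq`.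
[cite: Lang1990, Ch. 13 §4, Lemma 4.1 (PDF p. 203)] -/
theorem card_fixed_eq_classNumber_of_relIndex_mul_eq_of_isUnramifiedAtInfinitePlaces [IsGalois K L]
    [IsUnramifiedAtInfinitePlaces K L] {p : ℕ} (hp : p.Prime) (hdeg : Module.finrank K L = p)
    (hK : ¬ p ∣ classNumber K) {s : ℕ}
    (hs : {v : HeightOneSpectrum (𝓞 K) | v.asIdeal.ramificationIdxIn (𝓞 L) ≠ 1}.ncard ≤ s)
    (hidx : (unitsE L ⊓ (⊤ : Subgroup Lˣ).map (Herbrand.norm (L ≃ₐ[K] L))).relIndex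
        (unitsE L ⊓ (unitsIncl K L).range) * p = p ^ s) :
    Nat.card {c : ClassGroup (𝓞 L) // ∀ τ : L ≃ₐ[K] L, ClassGroup.mulEquiv (intAut τ) c = c} =
      classNumber K := by
  classical
  haveI : FiniteDimensional K L := Module.Finite.of_restrictScalars_finite ℚ K L
  have hcard : Nat.card (L ≃ₐ[K] L) = p := by rw [IsGalois.card_aut_eq_finrank, hdeg]
  haveI : Fact p.Prime := ⟨hp⟩
  haveI : IsCyclic (L ≃ₐ[K] L) := isCyclic_of_prime_card hcard
  obtain ⟨σ, hσ⟩ := IsCyclic.exists_generator (α := L ≃ₐ[K] L)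
  have h := ambiguousClassNumberFormula hσ
  rw [archFactor_eq_one, mul_one, finprod_ramificationIdxIn_eq_pow_of_prime hp hdeg,
    hdeg, mul_assoc, mul_comm p, hidx] at h
  set t := {v : HeightOneSpectrum (𝓞 K) | v.asIdeal.ramificationIdxIn (𝓞 L) ≠ 1}.ncard with ht
  set F := Nat.card {c : ClassGroup (𝓞 L) // ∀ τ : L ≃ₐ[K] L, ClassGroup.mulEquiv (intAut τ) c = c}
    with hF
  obtain ⟨d, hd⟩ := Nat.exists_eq_add_of_le hs
  rw [hd, pow_add, ← mul_assoc] at h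
  have hpt : 0 < p ^ t := pow_pos hp.pos t
  have h' : F * p ^ d = classNumber K := by
    have h2 : F * p ^ d * p ^ t = classNumber K * p ^ t := by rw [← h]; ring
    exact Nat.eq_of_mul_eq_mul_right hpt h2
  rcases d with _ | e
  · rwa [pow_zero, mul_one] at h'
  · exfalso
    exact hK ⟨F * p ^ e, by rw [← h', pow_succ]; ring⟩

/-- **Door U in prime degree, unramified at infinity: `p ∤ h_L`.**  `L/K` Galois of prime degree `p`,
unramified at the infinite places, `p ∤ h_K`, at most `s` ramified primes and
`[E_K : E_K ∩ N_{L/K} Lˣ] · p = p^s`: then `p ∤ h_L` (`#Cl(L)^G = h_K` is prime to `p`, and the fixed-point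
congruence `not_dvd_classNumber_of_isPGroup_of_not_dvd_card_fixed` finishes).  For `p = 2`, `s ≤ 2` this is
the shape of the BSD tree's «Chevalley door at 2». [cite: Lang1990, Ch. 13 §4, Lemma 4.1 (PDF p. 203)]
[cite: Greenberg2001IwasawaPastPresent, Prop. 2.1 p. 339 (the case s = 1)] -/
theorem not_dvd_classNumber_of_relIndex_mul_eq_of_isUnramifiedAtInfinitePlaces [IsGalois K L]
    [IsUnramifiedAtInfinitePlaces K L] {p : ℕ} (hp : p.Prime) (hdeg : Module.finrank K L = p)
    (hK : ¬ p ∣ classNumber K) {s : ℕ}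
    (hs : {v : HeightOneSpectrum (𝓞 K) | v.asIdeal.ramificationIdxIn (𝓞 L) ≠ 1}.ncard ≤ s)
    (hidx : (unitsE L ⊓ (⊤ : Subgroup Lˣ).map (Herbrand.norm (L ≃ₐ[K] L))).relIndex
        (unitsE L ⊓ (unitsIncl K L).range) * p = p ^ s) :
    ¬ p ∣ classNumber L := by
  haveI : FiniteDimensional K L := Module.Finite.of_restrictScalars_finite ℚ K L
  haveI : Fact p.Prime := ⟨hp⟩
  have hG : IsPGroup p (L ≃ₐ[K] L) :=
    IsPGroup.of_card (n := 1) (by rw [pow_one, IsGalois.card_aut_eq_finrank, hdeg])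
  refine not_dvd_classNumber_of_isPGroup_of_not_dvd_card_fixed hG ?_
  rw [card_fixed_eq_classNumber_of_relIndex_mul_eq_of_isUnramifiedAtInfinitePlaces hp hdeg hK hs hidx]
  exact hK

/-- **Chevalley in prime degree with all `s` primes counted, unramified at infinity: `#Cl(L)^G = h_K`.**
`L/K` Galois of prime degree `p`, unramified at the infinite places, with exactly `s` ramified primes and unit
norm index `[E_K : E_K ∩ N_{L/K} Lˣ] · p = p^s`: then `#Cl(L)^G · p^s = h_K · p^s`, i.e. `#Cl(L)^G = h_K` — no
hypothesis on `h_K`. [cite: Lang1990, Ch. 13 §4, Lemma 4.1 (PDF p. 203)] -/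
theorem card_fixed_eq_classNumber_of_ncard_eq_of_relIndex_mul_eq_of_isUnramifiedAtInfinitePlaces
    [IsGalois K L] [IsUnramifiedAtInfinitePlaces K L] {p : ℕ} (hp : p.Prime)
    (hdeg : Module.finrank K L = p) {s : ℕ}
    (hs : {v : HeightOneSpectrum (𝓞 K) | v.asIdeal.ramificationIdxIn (𝓞 L) ≠ 1}.ncard = s)
    (hidx : (unitsE L ⊓ (⊤ : Subgroup Lˣ).map (Herbrand.norm (L ≃ₐ[K] L))).relIndex
        (unitsE L ⊓ (unitsIncl K L).range) * p = p ^ s) :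
    Nat.card {c : ClassGroup (𝓞 L) // ∀ τ : L ≃ₐ[K] L, ClassGroup.mulEquiv (intAut τ) c = c} =
      classNumber K := by
  classical
  haveI : FiniteDimensional K L := Module.Finite.of_restrictScalars_finite ℚ K L
  have hcard : Nat.card (L ≃ₐ[K] L) = p := by rw [IsGalois.card_aut_eq_finrank, hdeg]
  haveI : Fact p.Prime := ⟨hp⟩
  haveI : IsCyclic (L ≃ₐ[K] L) := isCyclic_of_prime_card hcard
  obtain ⟨σ, hσ⟩ := IsCyclic.exists_generator (α := L ≃ₐ[K] L)
  have h := ambiguousClassNumberFormula hσ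
  rw [archFactor_eq_one, mul_one, finprod_ramificationIdxIn_eq_pow_of_prime hp hdeg, hs, hdeg, mul_assoc,
    mul_comm p, hidx] at h
  exact Nat.eq_of_mul_eq_mul_right (pow_pos hp.pos s) h

/-- **The core of door UG — `ord_p h_L = ord_p h_K` from `#Cl(L)^G = h_K` and the generation hypothesis,
for ANY prime degree, with no archimedean and no unit hypothesis.**  Let `L/K` be Galois of prime degree `p`
with `#Cl(L)^G = h_K`, and suppose the classes `[𝔭]` of the primes of `K` ramified in `L` generate `Cl(K)`
modulo `p`-th powers (`⟨[𝔭]⟩ · Cl(K)^p = Cl(K)`).  Then `ord_p h_L = ord_p h_K`.  Proof (genus theory after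
Chevalley's formula; the argument of `padicValNat_classNumber_eq_of_relIndex_mul_eq_of_sup_eq_top`, whose
Step 1 is now the hypothesis): with `f = σ − 1` on `Cl(L)`, `h_L = #Cl(L)^G · #f(Cl L) = h_K · #f(Cl L)`;
`N_{L/K}` kills `f(Cl L)`, sends the ambiguous class of the prime above a ramified `𝔭` to `[𝔭]` and `i(d)` to
`d^p`, so it maps `Cl(L)^G` onto — hence bijectively onto — `Cl(K)`; thus `f(Cl L)` contains no ambiguous class
`≠ 1`, and the fixed-point congruence for the `p`-group `G` gives `p ∤ #f(Cl L)`. [folklore]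
[cite: Lang1990, Ch. 13 §4, Lemma 4.1 and sequel (PDF pp. 203–204)]
[cite: NeukirchANT1999, Ch. III §1 Prop. (1.6) (ii), (iv)] -/
theorem padicValNat_classNumber_eq_of_card_fixed_eq_classNumber_of_sup_eq_top [IsGalois K L] {p : ℕ}
    (hp : p.Prime) (hdeg : Module.finrank K L = p)
    (hFix : Nat.card {c : ClassGroup (𝓞 L) // ∀ τ : L ≃ₐ[K] L, ClassGroup.mulEquiv (intAut τ) c = c} =
      classNumber K)
    (hgen : Subgroup.closure {c : ClassGroup (𝓞 K) | ∃ v : HeightOneSpectrum (𝓞 K),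
        v.asIdeal.ramificationIdxIn (𝓞 L) ≠ 1 ∧
          c = ClassGroup.mk0 ⟨v.asIdeal, mem_nonZeroDivisors_of_ne_zero v.ne_bot⟩} ⊔
      (powMonoidHom p : ClassGroup (𝓞 K) →* ClassGroup (𝓞 K)).range = ⊤) :
    padicValNat p (classNumber L) = padicValNat p (classNumber K) := by
  classical
  haveI : FiniteDimensional K L := Module.Finite.of_restrictScalars_finite ℚ K L
  haveI : Fact p.Prime := ⟨hp⟩
  have hcard : Nat.card (L ≃ₐ[K] L) = p := by rw [IsGalois.card_aut_eq_finrank, hdeg]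
  haveI : IsCyclic (L ≃ₐ[K] L) := isCyclic_of_prime_card hcard
  obtain ⟨σ, hσ⟩ := IsCyclic.exists_generator (α := L ≃ₐ[K] L)
  -- the Galois action on classes, `φ τ = (c ↦ τ · c)`
  set φ : (L ≃ₐ[K] L) → ClassGroup (𝓞 L) ≃* ClassGroup (𝓞 L) := fun τ => ClassGroup.mulEquiv (intAut τ)
    with hφ
  have hφ1 : φ 1 = MulEquiv.refl _ := mulEquiv_intAut_one
  have hφmul : ∀ τ τ' : L ≃ₐ[K] L, φ (τ * τ') = (φ τ').trans (φ τ) := fun τ τ' => mulEquiv_intAut_mul τ τ'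
  -- fixed by all `τ` iff fixed by the generator `σ`
  have hfix : ∀ c : ClassGroup (𝓞 L), (∀ τ : L ≃ₐ[K] L, φ τ c = c) ↔ φ σ c = c := by
    intro c
    refine ⟨fun h => h σ, fun h τ => ?_⟩
    obtain ⟨k, rfl⟩ := Herbrand.exists_pow_eq_of_forall_mem_zpowers hσ τ
    induction k with
    | zero => rw [pow_zero, hφ1, MulEquiv.refl_apply]
    | succ k ih => rw [pow_succ, hφmul, MulEquiv.trans_apply, h, ih]
  -- every `τ` commutes with `σ`
  have hcomm : ∀ (τ : L ≃ₐ[K] L) (c : ClassGroup (𝓞 L)), φ τ (φ σ c) = φ σ (φ τ c) := by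
    intro τ c
    obtain ⟨k, rfl⟩ := Herbrand.exists_pow_eq_of_forall_mem_zpowers hσ τ
    rw [← MulEquiv.trans_apply (φ σ) (φ (σ ^ k)), ← MulEquiv.trans_apply (φ (σ ^ k)) (φ σ), ← hφmul,
      ← hφmul, (Commute.self_pow σ k).eq]
  -- Step 2: `f = σ - 1`, `ker f = Cl(L)^G`, `h_L = h_K · #f(Cl L)`
  set f : ClassGroup (𝓞 L) →* ClassGroup (𝓞 L) := (φ σ).toMonoidHom / MonoidHom.id _ with hfdef
  have hf : ∀ c, f c = φ σ c / c := fun c => rfl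
  have hker : ∀ c, c ∈ f.ker ↔ ∀ τ : L ≃ₐ[K] L, φ τ c = c := fun c => by
    rw [MonoidHom.mem_ker, hf, div_eq_one, hfix]
  have hL : classNumber L = classNumber K * Nat.card f.range := by
    rw [← hFix, classNumber, ← Nat.card_eq_fintype_card, Subgroup.card_eq_card_quotient_mul_card_subgroup f.ker,
      Nat.card_congr (QuotientGroup.quotientKerEquivRange f).toEquiv, mul_comm]
    congr 1
    exact Nat.card_congr (Equiv.subtypeEquivRight fun c => hker c)
  -- Step 3: the norm kills `f(Cl L)` …
  have hNf : ∀ c, classGroupNorm K L (f c) = 1 := fun c => by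
    rw [hf, map_div, hφ, classGroupNorm_galois_smul, div_self']
  -- … and maps the ambiguous classes ONTO `Cl(K)` (generation hypothesis)
  have hNsurj : ∀ a : ClassGroup (𝓞 K), ∃ m : ClassGroup (𝓞 L),
      (∀ τ : L ≃ₐ[K] L, φ τ m = m) ∧ classGroupNorm K L m = a := by
    intro a
    have ha : a ∈ Subgroup.closure {c : ClassGroup (𝓞 K) | ∃ v : HeightOneSpectrum (𝓞 K),
        v.asIdeal.ramificationIdxIn (𝓞 L) ≠ 1 ∧
          c = ClassGroup.mk0 ⟨v.asIdeal, mem_nonZeroDivisors_of_ne_zero v.ne_bot⟩} ⊔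
      (powMonoidHom p : ClassGroup (𝓞 K) →* ClassGroup (𝓞 K)).range := by
      rw [hgen]; exact Subgroup.mem_top a
    obtain ⟨b, hb, c, hc, rfl⟩ := Subgroup.mem_sup.mp ha
    clear ha
    -- the part generated by the ramified primes
    have hb' : ∃ m : ClassGroup (𝓞 L), (∀ τ : L ≃ₐ[K] L, φ τ m = m) ∧ classGroupNorm K L m = b := by
      induction hb using Subgroup.closure_induction with
      | mem x hx =>
        obtain ⟨v, hv, rfl⟩ := hx
        exact exists_fixed_class_norm_eq_of_ramificationIdxIn_ne_one hp hdeg hv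
      | one => exact ⟨1, fun τ => map_one _, map_one _⟩
      | mul x y _ _ ihx ihy =>
        obtain ⟨m₁, hm₁, rfl⟩ := ihx
        obtain ⟨m₂, hm₂, rfl⟩ := ihy
        exact ⟨m₁ * m₂, fun τ => by rw [map_mul, hm₁ τ, hm₂ τ], map_mul _ _ _⟩
      | inv x _ ihx =>
        obtain ⟨m, hm, rfl⟩ := ihx
        exact ⟨m⁻¹, fun τ => by rw [map_inv, hm τ], map_inv _ _⟩
    -- the `p`-th powers: `d^p = N(i d)`
    obtain ⟨d, rfl⟩ := hc
    obtain ⟨m, hm, rfl⟩ := hb'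
    refine ⟨m * classGroupExtend K L d, fun τ => by rw [map_mul, hm τ, mulEquiv_intAut_classGroupExtend], ?_⟩
    rw [map_mul, classGroupNorm_classGroupExtend, hdeg, powMonoidHom_apply]
  -- hence (equal orders) injectively: an ambiguous class in `f(Cl L)` is trivial
  have htriv : ∀ y : ClassGroup (𝓞 L), y ∈ f.range → (∀ τ : L ≃ₐ[K] L, φ τ y = y) → y = 1 := by
    obtain ⟨H, hH⟩ := isSubgroup_fixed (K := K) (L := L)
    have hmemH : ∀ c : ClassGroup (𝓞 L), c ∈ H ↔ ∀ τ : L ≃ₐ[K] L, φ τ c = c := fun c => by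
      rw [← SetLike.mem_coe, hH]; rfl
    have hcardH : Nat.card H = Nat.card (ClassGroup (𝓞 K)) := by
      rw [Nat.card_eq_fintype_card (α := ClassGroup (𝓞 K)), ← classNumber, ← hFix]
      exact Nat.card_congr (Equiv.subtypeEquivRight fun c => hmemH c)
    set NH : H →* ClassGroup (𝓞 K) := (classGroupNorm K L).comp H.subtype with hNH
    have hsurj : Function.Surjective NH := fun a => by
      obtain ⟨m, hm, rfl⟩ := hNsurj a
      exact ⟨⟨m, (hmemH m).mpr hm⟩, rfl⟩
    have hbij : Function.Bijective NH := hsurj.bijective_of_nat_card_le hcardH.le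
    intro y hy hyfix
    obtain ⟨c, rfl⟩ := hy
    have h1 : NH ⟨f c, (hmemH _).mpr hyfix⟩ = NH 1 := by
      rw [map_one, hNH, MonoidHom.comp_apply, Subgroup.coe_subtype, hNf]
    exact congrArg Subtype.val (hbij.1 h1)
  -- Step 4: `G` acts on `f(Cl L)` with the single fixed point `1`, so `#f(Cl L) ≡ 1 (mod p)`
  have hstab : ∀ (τ : L ≃ₐ[K] L) (y : ClassGroup (𝓞 L)), y ∈ f.range → φ τ y ∈ f.range := by
    rintro τ y ⟨c, rfl⟩
    exact ⟨φ τ c, by rw [hf, hf, map_div, hcomm]⟩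
  let R : Type := f.range
  letI : MulAction (L ≃ₐ[K] L) R :=
    { smul := fun τ y => ⟨φ τ y.1, hstab τ y.1 y.2⟩
      one_smul := fun y => Subtype.ext (by
        change φ 1 y.1 = y.1
        rw [hφ1]; rfl)
      mul_smul := fun τ τ' y => Subtype.ext (by
        change φ (τ * τ') y.1 = φ τ (φ τ' y.1)
        rw [hφmul]; rfl) }
  haveI : Finite R := Subtype.finite
  have hfixR : Nat.card (MulAction.fixedPoints (L ≃ₐ[K] L) R) = 1 := by
    rw [Nat.card_eq_one_iff_unique]
    refine ⟨⟨fun a b => ?_⟩, ⟨⟨⟨1, one_mem _⟩, fun τ => Subtype.ext (map_one _)⟩⟩⟩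
    have key : ∀ y : MulAction.fixedPoints (L ≃ₐ[K] L) R, ((y : R) : ClassGroup (𝓞 L)) = 1 := fun y =>
      htriv _ (y : R).2 fun τ => congrArg Subtype.val (y.2 τ)
    exact Subtype.ext (Subtype.ext ((key a).trans (key b).symm))
  have hG : IsPGroup p (L ≃ₐ[K] L) := IsPGroup.of_card (n := 1) (by rw [pow_one, hcard])
  have hmod := hG.card_modEq_card_fixedPoints R
  rw [hfixR] at hmod
  have hndvd : ¬ p ∣ Nat.card f.range := fun hdvd => by
    have h10 : 1 ≡ 0 [MOD p] := hmod.symm.trans (Nat.modEq_zero_iff_dvd.mpr hdvd)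
    exact hp.one_lt.ne' (Nat.dvd_one.mp (Nat.modEq_zero_iff_dvd.mp h10))
  -- conclusion
  have hK0 : classNumber K ≠ 0 := Fintype.card_ne_zero
  have hR0 : Nat.card f.range ≠ 0 := Nat.card_pos.ne'
  rw [hL, padicValNat.mul hK0 hR0, padicValNat.eq_zero_of_not_dvd hndvd, add_zero]

/-- **Door UG in prime degree, unramified at infinity — `ord_p h_L = ord_p h_K`.**  `L/K` Galois of ANY prime
degree `p`, unramified at the infinite places, with exactly `s` ramified primes, unit norm index
`[E_K : E_K ∩ N_{L/K} Lˣ] · p = p^s`, and ramified classes generating `Cl(K)` modulo `p`-th powers: then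
`ord_p h_L = ord_p h_K` (Chevalley gives `#Cl(L)^G = h_K`, then the core
`padicValNat_classNumber_eq_of_card_fixed_eq_classNumber_of_sup_eq_top`).  The `p`-odd case is the tree's
`padicValNat_classNumber_eq_of_relIndex_mul_eq_of_sup_eq_top`. [folklore]
[cite: Lang1990, Ch. 13 §4, Lemma 4.1 and sequel (PDF pp. 203–204)] -/
theorem padicValNat_classNumber_eq_of_relIndex_mul_eq_of_sup_eq_top_of_isUnramifiedAtInfinitePlaces
    [IsGalois K L] [IsUnramifiedAtInfinitePlaces K L] {p : ℕ} (hp : p.Prime)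
    (hdeg : Module.finrank K L = p) {s : ℕ}
    (hs : {v : HeightOneSpectrum (𝓞 K) | v.asIdeal.ramificationIdxIn (𝓞 L) ≠ 1}.ncard = s)
    (hidx : (unitsE L ⊓ (⊤ : Subgroup Lˣ).map (Herbrand.norm (L ≃ₐ[K] L))).relIndex
        (unitsE L ⊓ (unitsIncl K L).range) * p = p ^ s)
    (hgen : Subgroup.closure {c : ClassGroup (𝓞 K) | ∃ v : HeightOneSpectrum (𝓞 K),
        v.asIdeal.ramificationIdxIn (𝓞 L) ≠ 1 ∧
          c = ClassGroup.mk0 ⟨v.asIdeal, mem_nonZeroDivisors_of_ne_zero v.ne_bot⟩} ⊔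
      (powMonoidHom p : ClassGroup (𝓞 K) →* ClassGroup (𝓞 K)).range = ⊤) :
    padicValNat p (classNumber L) = padicValNat p (classNumber K) :=
  padicValNat_classNumber_eq_of_card_fixed_eq_classNumber_of_sup_eq_top hp hdeg
    (card_fixed_eq_classNumber_of_ncard_eq_of_relIndex_mul_eq_of_isUnramifiedAtInfinitePlaces hp hdeg hs
      hidx) hgen

/-- In a finite commutative group every element is a `p`-power-torsion element times a `p`-th power
(`N = p · #M = p^k · b`, `p ∤ b`, `x p^k + y b = 1`: `c = c^{yb} · (c^{x p^{k-1}})^p`, `(c^{yb})^{p^k} = 1`).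
[folklore] -/
private theorem exists_torsion_mul_pow_eq' {M : Type*} [CommGroup M] [Finite M] {p : ℕ} (hp : p.Prime)
    (c : M) : ∃ a d : M, (∃ n : ℕ, a ^ p ^ n = 1) ∧ a * d ^ p = c := by
  set N := p * Nat.card M with hN
  have hN0 : N ≠ 0 := mul_ne_zero hp.ne_zero Nat.card_pos.ne'
  set k := N.factorization p with hk
  set b := N / p ^ k with hb
  have hkb : p ^ k * b = N := Nat.ordProj_mul_ordCompl_eq_self N p
  have hcop : Nat.Coprime (p ^ k) b := (Nat.coprime_ordCompl hp hN0).pow_left k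
  have hk1 : 1 ≤ k := (hp.dvd_iff_one_le_factorization hN0).mp (dvd_mul_right p _)
  obtain ⟨x, y, hxy⟩ := Nat.isCoprime_iff_coprime.mpr hcop
  refine ⟨c ^ (y * (b : ℤ)), c ^ (x * ((p ^ (k - 1) : ℕ) : ℤ)), ⟨k, ?_⟩, ?_⟩
  · rw [← zpow_natCast, ← zpow_mul]
    have h : y * (b : ℤ) * ((p ^ k : ℕ) : ℤ) = y * (p : ℤ) * (Nat.card M : ℤ) := by
      rw [mul_assoc, mul_comm (b : ℤ), ← Nat.cast_mul, hkb, hN, Nat.cast_mul, mul_assoc]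
    rw [h, zpow_mul, zpow_natCast, pow_card_eq_one']
  · rw [← zpow_natCast (c ^ _) p, ← zpow_mul, ← zpow_add]
    have h : y * (b : ℤ) + x * ((p ^ (k - 1) : ℕ) : ℤ) * (p : ℤ) = 1 := by
      rw [← hxy, mul_assoc x, ← Nat.cast_mul, ← pow_succ, Nat.sub_add_cancel hk1, add_comm]
    rw [h, zpow_one]

/-- **Door UG, `p`-primary form, ANY prime degree, unramified at infinity** («the `p`-part `A(K)` of `Cl(K)`
lies in the subgroup generated by the classes of the ramified primes»): `L/K` Galois of prime degree `p`,
unramified at the infinite places, exactly `s` ramified primes, `[E_K : E_K ∩ N_{L/K} Lˣ] · p = p^s`, and every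
class of `p`-power order in the subgroup of `Cl(K)` generated by the classes of the ramified primes: then
`ord_p h_L = ord_p h_K` (an element of order prime to `p` is a `p`-th power). [folklore]
[cite: Lang1990, Ch. 13 §4, Lemma 4.1 and sequel (PDF pp. 203–204)] -/
theorem padicValNat_classNumber_eq_of_relIndex_mul_eq_of_torsion_le_closure_of_isUnramifiedAtInfinitePlaces
    [IsGalois K L] [IsUnramifiedAtInfinitePlaces K L] {p : ℕ} (hp : p.Prime)
    (hdeg : Module.finrank K L = p) {s : ℕ}
    (hs : {v : HeightOneSpectrum (𝓞 K) | v.asIdeal.ramificationIdxIn (𝓞 L) ≠ 1}.ncard = s)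
    (hidx : (unitsE L ⊓ (⊤ : Subgroup Lˣ).map (Herbrand.norm (L ≃ₐ[K] L))).relIndex
        (unitsE L ⊓ (unitsIncl K L).range) * p = p ^ s)
    (hgen : ∀ c : ClassGroup (𝓞 K), (∃ n : ℕ, c ^ p ^ n = 1) →
      c ∈ Subgroup.closure {c : ClassGroup (𝓞 K) | ∃ v : HeightOneSpectrum (𝓞 K),
        v.asIdeal.ramificationIdxIn (𝓞 L) ≠ 1 ∧
          c = ClassGroup.mk0 ⟨v.asIdeal, mem_nonZeroDivisors_of_ne_zero v.ne_bot⟩}) :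
    padicValNat p (classNumber L) = padicValNat p (classNumber K) := by
  refine padicValNat_classNumber_eq_of_relIndex_mul_eq_of_sup_eq_top_of_isUnramifiedAtInfinitePlaces hp
    hdeg hs hidx ?_
  rw [eq_top_iff]
  intro c _
  obtain ⟨a, d, ha, rfl⟩ := exists_torsion_mul_pow_eq' hp c
  exact Subgroup.mul_mem_sup (hgen a ha) ⟨d, rfl⟩

end Literature.NumberTheory.NumberFields.AmbiguousClass

end
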